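import Literature.AlgebraicGeometry.Morphisms.CechModuleH2RefinementInjective
import HarnessLib

/-!
# A Čech `2`-class killed by an «eigenvalue clash» `n · c' = f^* c = n² · c`, `c' ∼ c`, vanishes
# (the Čech algebra of Oort–Mumford's parity argument for the unobstructedness of abelian varieties)

Topic `Literature/AlgebraicGeometry/Morphisms`; THEOREMS only (no definition, no named fact, no instance).  The FORMAL
BACKBONE of road (a′) of cell `hodgecm-mathlib`'s F-11 brick J4-(iv) «abelian varieties are unobstructed»
([Oort1971] §2.2, [MumfordAV1970] §13: the obstruction class `c` of an abelian variety satisfies `[n]^* c = n · c` by the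
functoriality of the obstruction along `[n]` (whose differential is `n`) and `[n]^* c = n² · c` because `H² = Λ² H¹` with
`[n]^* = n` on `H¹`; hence `(n² − n) c = 0` and `c = 0` in characteristic `0`), stripped of all geometry: in the module
Čech complex of ★ `Morphisms/CechModuleH2` on a family of AFFINE opens `𝒰` with a refinement `𝒲` covering every `U_i`,
a `2`-cocycle `z` on `𝒰` is a `2`-COBOUNDARY as soon as there are `2`-cocycles `p` («the pull-back `f^* z` refined to
`𝒲`») and `q` («the class of the pulled-back problem, refined to `𝒲`») on `𝒲` with

  `[p] = n · [q]` (functoriality + `df = n`), `[q] = [z|_𝒲]` (cover independence), `[p] = n² · [z|_𝒲]` (`f^* = n²`),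

and `n² − n` a unit of the coefficient ring (`n = 2` over a `ℚ`-algebra).  The only geometric input is the injectivity of
`Ȟ²(𝒰, M) → Ȟ²(𝒲, M)` for affine `𝒰` and affine-localizing `M` (★ `Morphisms/CechModuleH2RefinementInjective`,
[GortzWedhorn2023] Thm. 22.9).

* `CechMH2.mk_eq_zero_of_scaling_relations` — `[z|_𝒲] = 0` from the three relations;
* **`mem_cechMB2_of_scaling_relations`** — hence `z ∈ B²(𝒰, M)` (`𝒰` affine, `M` affine-localizing);
* `isUnit_two_mul_two_sub_two` — `2² − 2 = 2` is a unit in any `ℚ`-algebra (the instance of use);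
* `mem_cechMB2_of_components` — for a module with a finite frame of maps `π_a : M → N`, `σ_a : N → M`,
  `∑ σ_a π_a = 𝟙`, a `2`-cochain is a coboundary if all its components `π_a(o)` are;
* **`mem_cechMB2_of_componentwise_scaling_relations`** — the assembled criterion (frame + clash on every component).

F0P1b-p05 (g0), (R51) (iv-5): the slots `p`, `q` and the three relations are exactly what the bricks (iv-1b)
(functoriality, B-p08), (iv-2) (`𝒯 ≅ 𝒪^g`, `d[n] = n`, B-p16), the cover-independence of the obstruction class, and
(iv-4) (`[n]^* = n²` on `Ȟ²(𝒪)`, F0P1b-p04) deliver for the components of the obstruction cocycle of F2 A.  HC_CM is proved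
only modulo the 7 printed citations until rung 0 closes — nothing here bears on a summit statement.

## References
* [Oort1971] F. Oort, *Finite group schemes, local moduli for abelian varieties, and lifting problems*, Compositio
  Math. 23 (1971), §2.2 (Thm. 2.2.1 and its proof).
* [MumfordAV1970] D. Mumford, *Abelian Varieties* (1970), §13 Cor. 2 (`[n]^*` on `H²`), §15.
* [GortzWedhorn2023] U. Görtz, T. Wedhorn, *Algebraic Geometry II* (2023), Thm. 22.9 (p. 236), Cor. 21.81 (p. 185).
-/

noncomputable section

open CategoryTheory AlgebraicGeometry Limits TopologicalSpace Opposite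

universe u v w

namespace Literature.AlgebraicGeometry.Morphisms

variable {A : Type u} [CommRing A] {X : Scheme.{u}} (f : X ⟶ Spec (.of A)) (M : X.Modules)
  {ι : Type v} {κ : Type w} (U : ι → X.Opens) (W : κ → X.Opens) (τ : κ → ι) (hτ : ∀ j, W j ≤ U (τ j))

/-- `2² − 2 = 2` is a unit in a `ℚ`-algebra (the eigenvalue clash at `n = 2` in characteristic `0`).
[cite: Oort1971, §2.2 (proof of Thm. 2.2.1)] -/
theorem isUnit_two_mul_two_sub_two [Algebra ℚ A] : IsUnit ((2 : A) * 2 - 2) := by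
  have h : ((2 : A) * 2 - 2) = algebraMap ℚ A 2 := by
    rw [map_ofNat]; norm_num
  rw [h]
  exact (IsUnit.mk0 (2 : ℚ) two_ne_zero).map (algebraMap ℚ A)

/-- **The eigenvalue clash kills the refined class**: for `2`-cocycles `z` on `𝒰` and `p`, `q` on a refinement `𝒲`
with `[p] = n[q]`, `[q] = [z|_𝒲]` and `[p] = n²[z|_𝒲]` in `Ȟ²(𝒲, M)`, and `n² − n` a unit, `[z|_𝒲] = 0`.
[cite: Oort1971, §2.2 (proof of Thm. 2.2.1)] [cite: MumfordAV1970, §13 Cor. 2] -/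
theorem CechMH2.mk_eq_zero_of_scaling_relations {z : CechMC2 f M U} (hz : z ∈ cechMZ2 f M U)
    (p q : cechMZ2 f M W) (n : A) (hn : IsUnit (n * n - n))
    (hfunc : CechMH2.mk f M W p = n • CechMH2.mk f M W q)
    (hindep : CechMH2.mk f M W q =
      CechMH2.mk f M W ⟨cechMRefineC2 f M U W τ hτ z, refineMC2_mem_cechMZ2 f M U W τ hτ hz⟩)
    (hsq : CechMH2.mk f M W p =
      (n * n) • CechMH2.mk f M W ⟨cechMRefineC2 f M U W τ hτ z, refineMC2_mem_cechMZ2 f M U W τ hτ hz⟩) :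
    CechMH2.mk f M W ⟨cechMRefineC2 f M U W τ hτ z, refineMC2_mem_cechMZ2 f M U W τ hτ hz⟩ = 0 := by
  set c := CechMH2.mk f M W ⟨cechMRefineC2 f M U W τ hτ z, refineMC2_mem_cechMZ2 f M U W τ hτ hz⟩
  have h : (n * n - n) • c = 0 := by
    rw [sub_smul, ← hsq, hfunc, hindep, sub_self]
  obtain ⟨u, hu⟩ := hn
  calc c = ((↑u⁻¹ : A) * ↑u) • c := by rw [Units.inv_mul, one_smul]
    _ = (↑u⁻¹ : A) • ((n * n - n) • c) := by rw [mul_smul, hu]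
    _ = 0 := by rw [h, smul_zero]

/-- **A `2`-cocycle on a family of AFFINE opens is a COBOUNDARY when its refined class is caught in an eigenvalue clash**
(`M` affine-localizing, the refinement `𝒲` covering every `U_i`): with `p`, `q`, `n` as in
`CechMH2.mk_eq_zero_of_scaling_relations`, `z ∈ B²(𝒰, M)` — the injectivity of `Ȟ²(𝒰, M) → Ȟ²(𝒲, M)`
(★ `mem_cechMB2_of_refineMC2_mem_cechMB2_of_isAffineOpen`). This is the shape in which the unobstructedness of abelian
varieties is assembled: `z` = a component of the obstruction cocycle, `p` = its pull-back under `[n]` refined to the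
common refinement, `q` = the component of the obstruction of the same deformation on the pulled-back cover.
[cite: Oort1971, §2.2 (Thm. 2.2.1 and its proof)] [cite: GortzWedhorn2023, Thm. 22.9 (p. 236)] -/
theorem mem_cechMB2_of_scaling_relations (hM : Literature.AlgebraicGeometry.Modules.IsAffineLocalizing M)
    (hUaff : ∀ i, IsAffineOpen (U i)) (hUW : ∀ i, U i ≤ ⨆ j, W j)
    {z : CechMC2 f M U} (hz : z ∈ cechMZ2 f M U) (p q : cechMZ2 f M W) (n : A) (hn : IsUnit (n * n - n))
    (hfunc : CechMH2.mk f M W p = n • CechMH2.mk f M W q)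
    (hindep : CechMH2.mk f M W q =
      CechMH2.mk f M W ⟨cechMRefineC2 f M U W τ hτ z, refineMC2_mem_cechMZ2 f M U W τ hτ hz⟩)
    (hsq : CechMH2.mk f M W p =
      (n * n) • CechMH2.mk f M W ⟨cechMRefineC2 f M U W τ hτ z, refineMC2_mem_cechMZ2 f M U W τ hτ hz⟩) :
    z ∈ cechMB2 f M U :=
  mem_cechMB2_of_refineMC2_mem_cechMB2_of_isAffineOpen f M U W τ hτ hM hUaff hUW hz
    ((CechMH2.mk_eq_zero_iff f M W _).mp
      (CechMH2.mk_eq_zero_of_scaling_relations f M U W τ hτ hz p q n hn hfunc hindep hsq))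

/-! ## §2 Components: a cochain of a module with a finite «frame» of maps to `N` is a coboundary componentwise -/

/-- `cechMapC2` is additive in the morphism. [cite: GortzWedhorn2023, (21.16) Def. 21.71 (p. 181)] -/
theorem cechMapC2_add_apply {M N : X.Modules} (φ ψ : M ⟶ N) (e : CechMC2 f M U) :
    cechMapC2 f (φ + ψ) U e = cechMapC2 f φ U e + cechMapC2 f ψ U e := by
  funext i j l
  rw [Pi.add_apply, Pi.add_apply, Pi.add_apply, cechMapC2_apply, cechMapC2_apply, cechMapC2_apply,
    MSections.app_apply, MSections.app_apply, MSections.app_apply, Scheme.Modules.Hom.add_app]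
  rfl

/-- `cechMapC2` of a finite sum of morphisms. [cite: GortzWedhorn2023, (21.16) Def. 21.71 (p. 181)] -/
theorem cechMapC2_sum_apply {M N : X.Modules} {I : Type*} (s : Finset I) (φ : I → (M ⟶ N)) (e : CechMC2 f M U) :
    cechMapC2 f (∑ a ∈ s, φ a) U e = ∑ a ∈ s, cechMapC2 f (φ a) U e := by
  classical
  induction s using Finset.induction_on with
  | empty =>
    rw [Finset.sum_empty, Finset.sum_empty]
    funext i j l
    rw [cechMapC2_apply, MSections.app_apply, Scheme.Modules.Hom.zero_app]
    rfl
  | insert a s ha ih => rw [Finset.sum_insert ha, Finset.sum_insert ha, cechMapC2_add_apply, ih]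

/-- **Componentwise criterion**: if `M` carries maps `π_a : M → N`, `σ_a : N → M` with `∑ σ_a π_a = 𝟙` (`a` in a finite
set; e.g. `M ≅ N^g` a free module with its projections and inclusions, the case of the tangent sheaf of an abelian
variety, `𝒯 ≅ 𝒪 ⊗ Lie`), then a `2`-cochain of `M` all of whose components `π_a(o)` are `2`-coboundaries of `N` is a
`2`-coboundary of `M`. [cite: MumfordAV1970, §13 Cor. 2] [cite: GortzWedhorn2023, (21.16) Def. 21.71 (p. 181)] -/
theorem mem_cechMB2_of_components {M N : X.Modules} {I : Type*} [Fintype I] (π : I → (M ⟶ N)) (σ : I → (N ⟶ M))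
    (hπσ : ∑ a, π a ≫ σ a = 𝟙 M) {o : CechMC2 f M U} (h : ∀ a, cechMapC2 f (π a) U o ∈ cechMB2 f N U) :
    o ∈ cechMB2 f M U := by
  have ho : o = ∑ a, cechMapC2 f (σ a) U (cechMapC2 f (π a) U o) := by
    have h1 : cechMapC2 f (𝟙 M) U o = o := funext fun i => funext fun j => funext fun l => rfl
    conv_lhs => rw [← h1, ← hπσ, cechMapC2_sum_apply]
    exact Finset.sum_congr rfl fun a _ => funext fun i => funext fun j => funext fun l => rfl
  rw [ho]
  exact Submodule.sum_mem _ fun a _ => mapC2_mem_cechMB2 f (σ a) U (h a)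

/-! ## §3 The assembled criterion: frame + eigenvalue clash on every component ⇒ coboundary -/

/-- **A `2`-cocycle `o` of `M` on an affine family `𝒰` is a coboundary when `M` has a finite frame of maps to an
affine-localizing `N` (`∑ σ_a π_a = 𝟙`) and every component `π_a(o)`, refined to a covering refinement `𝒲`, is caught in the
eigenvalue clash of `CechMH2.mk_eq_zero_of_scaling_relations` (`[p_a] = n[q_a]`, `[q_a] = [π_a(o)|_𝒲]`,
`[p_a] = n²[π_a(o)|_𝒲]`, `n² − n` a unit).**  With `M = 𝒯_{X_s}`, `N = 𝒪`, `n = 2`, `o` the obstruction cocycle of a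
deformation of an abelian variety, `p_a` its pull-back under `[2]` and `q_a` the obstruction on the pulled-back cover, this
is «abelian varieties are unobstructed» ([Oort1971] Thm. 2.2.1) reduced to its four inputs (functoriality of the
obstruction with `d[2] = 2`; cover independence; `[2]^* = 4` on `Ȟ²(𝒪)`; `𝒯` free).
[cite: Oort1971, §2.2 (Thm. 2.2.1 and its proof)] [cite: MumfordAV1970, §13 Cor. 2] -/
theorem mem_cechMB2_of_componentwise_scaling_relations {M N : X.Modules}
    (hN : Literature.AlgebraicGeometry.Modules.IsAffineLocalizing N) (hUaff : ∀ i, IsAffineOpen (U i))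
    (hUW : ∀ i, U i ≤ ⨆ j, W j) {I : Type*} [Fintype I] (π : I → (M ⟶ N)) (σ : I → (N ⟶ M))
    (hπσ : ∑ a, π a ≫ σ a = 𝟙 M) {o : CechMC2 f M U} (ho : o ∈ cechMZ2 f M U) (n : A) (hn : IsUnit (n * n - n))
    (hrel : ∀ a, ∃ p q : cechMZ2 f N W,
      CechMH2.mk f N W p = n • CechMH2.mk f N W q ∧
      CechMH2.mk f N W q = CechMH2.mk f N W ⟨cechMRefineC2 f N U W τ hτ (cechMapC2 f (π a) U o),
        refineMC2_mem_cechMZ2 f N U W τ hτ (mapC2_mem_cechMZ2 f (π a) U ho)⟩ ∧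
      CechMH2.mk f N W p = (n * n) • CechMH2.mk f N W ⟨cechMRefineC2 f N U W τ hτ (cechMapC2 f (π a) U o),
        refineMC2_mem_cechMZ2 f N U W τ hτ (mapC2_mem_cechMZ2 f (π a) U ho)⟩) :
    o ∈ cechMB2 f M U := by
  refine mem_cechMB2_of_components f U π σ hπσ fun a => ?_
  obtain ⟨p, q, h₁, h₂, h₃⟩ := hrel a
  exact mem_cechMB2_of_scaling_relations f N U W τ hτ hN hUaff hUW (mapC2_mem_cechMZ2 f (π a) U ho) p q n hn
    h₁ h₂ h₃

end Literature.AlgebraicGeometry.Morphisms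

end
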